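import Literature.Probability.LatticeModels.TorusBlockKernelFloor
import HarnessLib

/-!
# The incoherent remainder of a block kernel: Fourier form and an infrared bound

Continuation of `TorusBlockKernelFloor.lean`. For a symmetric translation-invariant kernel `K` on
`(ℤ/Mℤ)^d`, `M = b·m`, with `κ(z) = K(0,z)` and block indicator `1_B` of the block of the origin,
the diagonal block sum is, in Fourier variables (`torusFourier`, unnormalised, Friedli–Velenik §10.4),

  `K_b(0,0) = M^{-d} Σ_k Re κ̂(k) |1̂_B(k)|² = b^{2d} Λ/M^{2d} + R_b`,
  `R_b := M^{-d} Σ_{k ≠ 0} Re κ̂(k) |1̂_B(k)|²`                      (`blockKernel_zero_eq_fourier`,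
                                                                      `blockKernel_zero_eq_coherent_add`),

so that the floor of `TorusBlockKernelFloor.lean` reads `K_b(x,y) ≥ b^{2d}Λ/M^{2d} - R_b`
(`blockKernel_floor_remainder`): COHERENT order-parameter term minus INCOHERENT remainder.

The bound of the remainder under an infrared bound (`d = 2`: `R_b ≤ 18 B b³`, hence
`K_b(x,y) ≥ b⁴Λ/M⁴ - 18 B b³`) is in `TorusBlockKernelInfraredFloor.lean`; here only the generic
ingredients `|1̂_B(k)| ≤ b^d` and Plancherel `Σ_k |1̂_B(k)|² = M^d b^d` are recorded.

Sources: finite-torus Fourier analysis as in S. Friedli, Y. Velenik (2017) §10.4; the infrared-bound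
mechanism is that of J. Fröhlich, B. Simon, T. Spencer (1976) §3 and T. Kennedy, E. H. Lieb,
B. S. Shastry (1988); the block estimate itself is elementary (folklore). No definition is introduced.
-/

noncomputable section

open Finset Complex
open scoped BigOperators ComplexConjugate Real

namespace Literature.Probability.LatticeModels

namespace TorusBlock

variable {d b m M : ℕ} [NeZero M] [NeZero m]

/-! ### The block indicator in Fourier variables -/

omit [NeZero m] in
/-- `|1̂_B(k)| ≤ b^d`: the Fourier transform of the block indicator is bounded by its mass.
[folklore] -/
theorem norm_torusFourier_blockIndicator_le (hM : M = b * m) (k : TorusSite d M) :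
    ‖torusFourier (fun x : TorusSite d M =>
        ((if ∀ i : Fin d, (x i).val / b = ((0 : TorusSite d M) i).val / b then (1 : ℝ) else 0 : ℝ) : ℂ))
        k‖ ≤ (b : ℝ) ^ d := by
  rw [torusFourier_eq_sum_torusChar]
  refine (norm_sum_le _ _).trans ?_
  have h : ∀ x : TorusSite d M,
      ‖(((if ∀ i : Fin d, (x i).val / b = ((0 : TorusSite d M) i).val / b then (1 : ℝ) else 0 : ℝ) : ℂ)) *
          conj (torusChar k x)‖ =
        (if ∀ i : Fin d, (x i).val / b = ((0 : TorusSite d M) i).val / b then (1 : ℝ) else 0) := by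
    intro x
    rw [norm_mul, Complex.norm_conj, norm_torusChar, mul_one, Complex.norm_real,
      Real.norm_of_nonneg (by positivity)]
  simp_rw [h]
  rw [sum_blockIndicator hM 0]

omit [NeZero m] in
/-- Plancherel for the block indicator: `Σ_k |1̂_B(k)|² = M^d b^d`. [folklore] -/
theorem sum_norm_sq_torusFourier_blockIndicator (hM : M = b * m) :
    ∑ k, ‖torusFourier (fun x : TorusSite d M =>
        ((if ∀ i : Fin d, (x i).val / b = ((0 : TorusSite d M) i).val / b then (1 : ℝ) else 0 : ℝ) : ℂ))
        k‖ ^ 2 = (M : ℝ) ^ d * (b : ℝ) ^ d := by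
  rw [torusFourier_plancherel_holds (d := d) (L := M)]
  congr 1
  have h : ∀ x : TorusSite d M,
      ‖(((if ∀ i : Fin d, (x i).val / b = ((0 : TorusSite d M) i).val / b then (1 : ℝ) else 0 : ℝ) : ℂ))‖ ^ 2
        = (if ∀ i : Fin d, (x i).val / b = ((0 : TorusSite d M) i).val / b then (1 : ℝ) else 0) := by
    intro x
    split_ifs <;> simp
  simp_rw [h]
  exact sum_blockIndicator hM 0

/-! ### Fourier form of the diagonal block sum -/

/-- **The diagonal block sum in Fourier variables**: for symmetric translation-invariant `K` with
`κ(z) = K(0,z)`, `K_b(0,0) = M^{-d} Σ_k Re κ̂(k) |1̂_B(k)|²`. (`sum_sum_mul_torusFourierInv_re` with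
`g = κ̂` and Fourier inversion.) [folklore] -/
theorem blockKernel_zero_eq_fourier (K : TorusSite d M → TorusSite d M → ℝ)
    (hT : ∀ v x y : TorusSite d M, K (x + v) (y + v) = K x y) (hS : ∀ x y : TorusSite d M, K x y = K y x) :
    (∑ x' : TorusSite d M, ∑ y' : TorusSite d M,
      if (∀ i : Fin d, (x' i).val / b = ((0 : TorusSite d M) i).val / b) ∧
          (∀ i : Fin d, (y' i).val / b = ((0 : TorusSite d M) i).val / b)
      then K x' y' else 0) =
    (((M : ℝ) ^ d)⁻¹) * ∑ k, (torusFourier (fun z => (K 0 z : ℂ)) k).re *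
      ‖torusFourier (fun x : TorusSite d M =>
        ((if ∀ i : Fin d, (x i).val / b = ((0 : TorusSite d M) i).val / b then (1 : ℝ) else 0 : ℝ) : ℂ))
        k‖ ^ 2 := by
  classical
  set r : TorusSite d M → ℝ := fun x =>
    if ∀ i : Fin d, (x i).val / b = ((0 : TorusSite d M) i).val / b then 1 else 0 with hr
  have h := sum_sum_mul_torusFourierInv_re (d := d) (L := M) (torusFourier (fun z => (K 0 z : ℂ))) r
  have hinv : ∀ z, (torusFourierInv (torusFourier (fun z => (K 0 z : ℂ))) z).re = K 0 z := fun z => by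
    have := congrFun (torusFourier_inversion_holds (d := d) (L := M) (fun z => (K 0 z : ℂ))) z
    rw [this, Complex.ofReal_re]
  have hK : ∀ x y : TorusSite d M, K 0 (x - y) = K x y := fun x y => by
    have := hT y 0 (x - y)
    rw [zero_add, sub_add_cancel] at this
    rw [← this, hS]
  simp_rw [hinv, hK] at h
  rw [← h]
  exact Finset.sum_congr rfl fun x _ => Finset.sum_congr rfl fun y _ =>
    (blockIndicator_mul K 0 0 x y).symm

omit [NeZero m] in
/-- **Coherent term plus remainder**: `K_b(0,0) = b^{2d} Λ / M^{2d} + M^{-d} Σ_{k ≠ 0} Re κ̂(k)|1̂_B(k)|²`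
(`Λ = Σ_{x,y} K`; the `k = 0` term is `Re κ̂(0) = Σ_z K(0,z) = Λ/M^d` times `|1̂_B(0)|² = b^{2d}`).
[folklore] -/
theorem blockKernel_zero_eq_coherent_add (hM : M = b * m) (K : TorusSite d M → TorusSite d M → ℝ)
    (hT : ∀ v x y : TorusSite d M, K (x + v) (y + v) = K x y) (hS : ∀ x y : TorusSite d M, K x y = K y x) :
    (∑ x' : TorusSite d M, ∑ y' : TorusSite d M,
      if (∀ i : Fin d, (x' i).val / b = ((0 : TorusSite d M) i).val / b) ∧
          (∀ i : Fin d, (y' i).val / b = ((0 : TorusSite d M) i).val / b)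
      then K x' y' else 0) =
    ((b : ℝ) ^ d) ^ 2 * (∑ x' : TorusSite d M, ∑ y' : TorusSite d M, K x' y') / ((M : ℝ) ^ d) ^ 2 +
      (((M : ℝ) ^ d)⁻¹) * ∑ k ∈ Finset.univ.erase (0 : TorusSite d M),
        (torusFourier (fun z => (K 0 z : ℂ)) k).re *
        ‖torusFourier (fun x : TorusSite d M =>
          ((if ∀ i : Fin d, (x i).val / b = ((0 : TorusSite d M) i).val / b then (1 : ℝ) else 0 : ℝ) : ℂ))
          k‖ ^ 2 := by
  classical
  rw [blockKernel_zero_eq_fourier K hT hS, ← Finset.add_sum_erase _ _ (Finset.mem_univ 0),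
    mul_add]
  congr 1
  -- the zero mode
  rw [torusFourier_apply_zero, torusFourier_apply_zero]
  have h1 : (∑ z : TorusSite d M, (K 0 z : ℂ)).re = ∑ z, K 0 z := by
    rw [← Complex.ofReal_sum, Complex.ofReal_re]
  have h2 : ‖∑ x : TorusSite d M,
      (((if ∀ i : Fin d, (x i).val / b = ((0 : TorusSite d M) i).val / b then (1 : ℝ) else 0 : ℝ) : ℂ))‖
      = (b : ℝ) ^ d := by
    rw [← Complex.ofReal_sum, Complex.norm_real, Real.norm_of_nonneg
      (Finset.sum_nonneg fun x _ => by positivity), sum_blockIndicator hM 0]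
  rw [h1, h2, sum_sum_eq_card_mul_rowSum K hT]
  have hne : ((M : ℝ) ^ d) ≠ 0 := by
    have : (0 : ℝ) < M := by exact_mod_cast Nat.pos_of_ne_zero (NeZero.ne M)
    positivity
  field_simp

/-- **Floor = coherent term minus incoherent remainder** (any `d`): for symmetric,
translation-invariant `K` with nonnegative quadratic form,
`K_b(x,y) ≥ b^{2d}Λ/M^{2d} - M^{-d} Σ_{k ≠ 0} Re κ̂(k)|1̂_B(k)|²`. [folklore] -/
theorem blockKernel_floor_remainder (hM : M = b * m) (K : TorusSite d M → TorusSite d M → ℝ)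
    (hT : ∀ v x y : TorusSite d M, K (x + v) (y + v) = K x y) (hS : ∀ x y : TorusSite d M, K x y = K y x)
    (hP : ∀ c : TorusSite d M → ℝ, 0 ≤ ∑ x, ∑ y, c x * c y * K x y) (x y : TorusSite d M) :
    ((b : ℝ) ^ d) ^ 2 * (∑ x' : TorusSite d M, ∑ y' : TorusSite d M, K x' y') / ((M : ℝ) ^ d) ^ 2 -
      (((M : ℝ) ^ d)⁻¹) * ∑ k ∈ Finset.univ.erase (0 : TorusSite d M),
        (torusFourier (fun z => (K 0 z : ℂ)) k).re *
        ‖torusFourier (fun x : TorusSite d M =>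
          ((if ∀ i : Fin d, (x i).val / b = ((0 : TorusSite d M) i).val / b then (1 : ℝ) else 0 : ℝ) : ℂ))
          k‖ ^ 2 ≤
      ∑ x' : TorusSite d M, ∑ y' : TorusSite d M,
        if (∀ i : Fin d, (x' i).val / b = (x i).val / b) ∧ (∀ i : Fin d, (y' i).val / b = (y i).val / b)
        then K x' y' else 0 := by
  have h1 := blockKernel_floor hM K hT hS hP x y
  have h2 := blockKernel_zero_eq_coherent_add hM K hT hS
  have h3 : 2 * ((b : ℝ) ^ d) ^ 2 * (∑ x' : TorusSite d M, ∑ y' : TorusSite d M, K x' y') /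
      ((M : ℝ) ^ d) ^ 2 = 2 * (((b : ℝ) ^ d) ^ 2 * (∑ x' : TorusSite d M, ∑ y' : TorusSite d M, K x' y') /
      ((M : ℝ) ^ d) ^ 2) := by ring
  rw [h3] at h1
  linarith
end TorusBlock

end Literature.Probability.LatticeModels

end
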